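import Summits.Parity.GeneralizedHardyLittlewood.Theses.LinnikGallagherMV
import Literature.NumberTheory.Sieve.GoldbachLinnikGallagherExists

/-!
# Route `LinnikGallagherMV` — the target `LinnikGallagherExists` (stmt-Parity-20511, rung F-LGE of Parity)

LINNIK'S THEOREM (Linnik 1953; Gallagher 1975, Theorem 1): there is `K` such that every sufficiently
large even `N` is a sum of two primes and at most `K` powers of two — `∃ K, goldbach_linnik_with K`.
The route's rank-0 target is VERBATIM the tree theorem
`Literature.NumberTheory.Sieve.GoldbachLinnik.linnikGallagher_exists`
(`Literature/NumberTheory/Sieve/GoldbachLinnikGallagherExists.lean`, p543960: the Assembly applied to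
the tree theorems `pointwiseMajorArcsMV`, `PintzRuzsa2003.gallagherLargeDeviationQual`,
`meanSquareCrude`); this file closes the item by `exact`.  HONESTY LABEL (director-frontier
2026-08-27, verbatim in the route file): this is a FORMALISATION floor rung of the F-P1 family —
formalisation-first of Linnik 1953 / Gallagher 1975 by an internal assembly over the tree's proved
Montgomery–Vaughan major arcs; no new mathematics, NO value of `K` is claimed (the record `K = 8`,
Pintz–Ruzsa 2020, is not used), never distance-to-Goldbach, never summit credit.

References: Yu. V. Linnik, Trudy Mat. Inst. Steklov 38 (1951) / Mat. Sb. 32 (1953) [Linnik1953];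
P. X. Gallagher, Invent. Math. 29 (1975), Theorem 1 [Gallagher1975]; D. R. Heath-Brown, J.-C. Puchta,
Asian J. Math. 6 (2002) [HeathbrownPuchta2002]; J. Pintz, I. Z. Ruzsa, Acta Math. Hungar. (2020)
[PintzRuzsa2020].
-/

namespace Summit.Parity.GeneralizedHardyLittlewood.Theorems

/-- **LINNIK'S THEOREM — target `LinnikGallagherExists` PROVED** (item stmt-Parity-20511, rung F-LGE):
`∃ K : ℕ, goldbach_linnik_with K`, i.e. for some `K` every sufficiently large even `N` is
`p + q + 2^(e_1) + … + 2^(e_k)` with `p, q` prime and `k ≤ K` — by the Literature theorem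
`GoldbachLinnik.linnikGallagher_exists` (unconditional; no value of `K`; formalisation floor rung,
never distance-to-Goldbach). [cite: Gallagher1975, Theorem 1; Linnik1953, Theorem 1] -/
theorem linnikGallagherMV_linnikGallagherExists_proof :
    Summit.Parity.GeneralizedHardyLittlewood.Theses.LinnikGallagherMV.LinnikGallagherExists :=
  Literature.NumberTheory.Sieve.GoldbachLinnik.linnikGallagher_exists

end Summit.Parity.GeneralizedHardyLittlewood.Theorems
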